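import Literature.NumberTheory.EllipticCurves.CompactSelmerTowerNormProofs
import Literature.NumberTheory.EllipticCurves.IwasawaTwistModPShapiroRes
import Literature.NumberTheory.GaloisRepresentations.ContinuousCorestrictionResNormal
import Literature.NumberTheory.GaloisRepresentations.ContinuousCorestrictionComp
import HarnessLib

/-!
# `Cor_{K_{n+1}/K_n} (proj_{n+1} s) = proj_n s` on the `Λ`-adic Selmer module `𝔖_p(K_∞)`: the
# restriction/norm pin of `LambdaAdicSelmerData` IS corestriction-compatibility when `E(K)[p] = 0`
# (proofs file: theorems only, no definition, no named fact)

Topic `NumberTheory/EllipticCurves`; namespaces `Literature.NumberTheory.EllipticCurves.ZpExtension`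
(group-theoretic part) and `WeierstrassCurve.LambdaAdicSelmerData`. Cell `pub/bsd-print-x9`, D1 road of the
shared μ-residual of rows 9/10 (PORT-ALGEBRA-LAYER §5 step 2, "control maps"): Howard's compact control map
`𝔖 = lim←_n H¹(K_n, T_p E) → H¹(K, T_𝔮/p^k T_𝔮)` is, at finite level, `cor_{Γ_n}^{Γ_K} ∘ H¹(a ↦ 1 ⊗ a)`
(`ZpExtension.coresEisenstein`, companion file `ZpExtensionEisensteinTwistCores`), which is independent of the
auxiliary level `n` on CORESTRICTION-compatible families (`coresEisenstein_coresLe`). The tree pins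
`𝔖_p(K_∞)` (`WeierstrassCurve.LambdaAdicSelmerData`, Perrin-Riou 1987 §0 / Howard 2004 Def. 2.2.3) by the
RESTRICTION/NORM identity `res_{K_n}^{K_{n+1}} (proj_n s) = Σ_{i<p} conj_{γ^{p^n i}} (proj_{n+1} s)`
(`proj_norm`). This file proves that the two agree:

* §1 (any field `K`, any topological representation `X` of `Γ_K`, `κ : ZpExtension K p` with topological
  generator `γ`): `layerIndex_pow_of_isTopGenerator` (`κ̄_m(γ^j) = j`) and
  **`resLe_coresLe_layer_succ_eq_sum_conjMap`**: `res_{Γ_n → Γ_{n+1}} (cor_{Γ_{n+1} → Γ_n} ξ) =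
  Σ_{i<p} γ^{p^n i} · ξ` on `H¹(Γ_{n+1}, X)` — the normal case of the double-coset formula
  (`resLe_coresLe_eq_sum_conjMap`) with the representatives `γ^{p^n i}` (enumeration of `Γ_n/Γ_{n+1}` by
  `κ̄_{n+1}/p^n`, `sum_layerQuotient_eq`). (The tree's `Kato2004.IwasawaH1LayerNorm.resLe_coresLe_layer_eq_sum`
  is the same statement for `K = ℚ`; here `K` is arbitrary, as the anticyclotomic tower needs.)
* §2 (an elliptic curve `E = V` over a number field `K`, `D : V.LambdaAdicSelmerData κ γ`,
  `E(K)[p] = 0`): **`coresLe_proj_succ_eq_proj`**: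
  `cor_{Γ_{n+1} → Γ_n} (proj (n+1) s k) = proj n s k` in `H¹(Γ_n, E[p^k])` for every `s ∈ 𝔖_p(K_∞)`, `n`, `k`
  — both sides have the same restriction to `Γ_{n+1}` (§1 + `proj_norm`), and restriction along the layers
  is injective when `E(K)[p] = 0` (`E(K_∞)[p^∞] = 0`, tree `resPi_layer_injective_of_noPTorsion` /
  `resOfLe_injective_of_forall_fixed_eq_zero`). Iterated form `coresLe_proj_eq_proj` (`n ≤ n'`, `coresLe_comp`).
  The `k`-th component `proj n s k : torsionH1Over (p^k) Γ_n` is `continuousCohomology 1 (subgroupRep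
  (torsionGaloisModule (p^k)).toTopRep Γ_n)` definitionally (`discreteTopRep_geomTorsion_eq`), the currency of
  the tree's `coresLe` / `conjMap` / `coresEisenstein`.

Consequence (recorded, proved in the companion once it is in the tree): for `J ≤ n ≤ n'`,
`coresEisenstein n' (proj n' s k) = coresEisenstein n (proj n s k)` — the finite-level control map of the
shared μ-item's D1 road is well defined on `𝔖_p(K_∞)`. BSD is not proved by any of this.

References: [PerrinRiou1987BSMF] B. Perrin-Riou, Bull. SMF 115 (1987), §0 p. 402 (`𝔖_p(L) = lim← S_p(F')`
along corestriction); [Howard2004HeegnerKolyvagin] B. Howard, Compositio Math. 140 (2004), §2.2, Def. 2.2.3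
(`𝔖 = H¹(K, 𝐓) = lim← H¹(K_n, T)`), Lemma 2.2.7 / Prop. 2.2.8; [NeukirchSchmidtWingberg2008] I §5
(1.5.6)–(1.5.7) (`res ∘ cor`), Prop. 1.5.3; [GreenbergLNM1716] §3 Lemma 3.1, §4 p. 109 (`E(F_∞)[p^∞] = 0`
when `E(F)[p] = 0`); [Washington1997] §13.1–§13.2.
-/

noncomputable section

open scoped Topology Classical
open Field CategoryTheory

universe u v

namespace Literature.NumberTheory.EllipticCurves

open Literature.NumberTheory.GaloisRepresentations

namespace ZpExtension

/-! ## §1 `res ∘ cor = Σ_{i<p} conj_{γ^{p^n i}}` along consecutive layers of a `ℤ_p`-extension -/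

section Layers

variable {K : Type u} [Field K] {p : ℕ} [hp : Fact p.Prime] (κ : ZpExtension K p)
  {γ : absoluteGaloisGroup K}

/-- `κ̄_m(γ^j) = j` for a topological generator `γ` (`κ γ = 1`). [cite: Washington1997, §13.1–§13.2] -/
theorem layerIndex_pow_of_isTopGenerator (hγ : κ.IsTopGenerator γ) (m j : ℕ) :
    κ.layerIndex m (γ ^ j) = (j : ZMod (p ^ m)) := by
  induction j with
  | zero => rw [pow_zero, layerIndex_one, Nat.cast_zero]
  | succ j ih => rw [pow_succ, layerIndex_mul, ih, κ.layerIndex_eq_one_of_isTopGenerator m hγ, Nat.cast_succ]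

/-- For a topological generator `γ`, conjugation by `g` on `H¹(Γ_m, X)` only depends on `κ̄_m(g)`:
`g · ξ = γ^{κ̄_m(g)} · ξ`. [cite: SerreLocalFields1979, VII.§5 Prop. 3] [cite: Washington1997, §13.1–§13.2] -/
theorem conjMap_eq_conjMap_pow_of_isTopGenerator {R : Type v} [CommRing R] [TopologicalSpace R]
    (X : TopRep.{u} R (absoluteGaloisGroup K)) (hγ : κ.IsTopGenerator γ) (m : ℕ) (g : absoluteGaloisGroup K)
    (ξ : continuousCohomology 1 (subgroupRep X (κ.layerSubgroup m))) :
    conjMap X (κ.layerSubgroup m) g 1 ξ =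
      conjMap X (κ.layerSubgroup m) (γ ^ (κ.layerIndex m g).val) 1 ξ := by
  haveI : NeZero (p ^ m) := ⟨pow_ne_zero _ hp.out.ne_zero⟩
  refine conjMap_apply_one_eq_of_inv_mul_mem X (κ.layerSubgroup m) ?_ ξ
  rw [← κ.layerIndex_eq_zero_iff, layerIndex_mul, layerIndex_inv, κ.layerIndex_pow_of_isTopGenerator hγ,
    ZMod.natCast_zmod_val, neg_add_cancel]

/-- **`res_{Γ_n → Γ_{n+1}} ∘ cor_{Γ_{n+1} → Γ_n} = Σ_{i<p} conj_{γ^{p^n i}}`** on `H¹(Γ_{n+1}, X)`, for any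
topological representation `X` of `Γ_K`, any `ℤ_p`-extension `κ` of any field `K` and a topological generator
`γ`: the normal double-coset formula (`resLe_coresLe_eq_sum_conjMap`) with the cosets of `Γ_n/Γ_{n+1}`
enumerated by `κ̄_{n+1}/p^n` (`sum_layerQuotient_eq`) and represented by `γ^{p^n i}`, `i < p`.
[cite: NeukirchSchmidtWingberg2008, I §5 (1.5.6)–(1.5.7)] [cite: Washington1997, §13.1–§13.2] -/
theorem resLe_coresLe_layer_succ_eq_sum_conjMap {R : Type v} [CommRing R] [TopologicalSpace R]
    (X : TopRep.{u} R (absoluteGaloisGroup K)) (hγ : κ.IsTopGenerator γ) (n : ℕ)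
    [Fintype (κ.layerSubgroup n ⧸ (κ.layerSubgroup (n + 1)).subgroupOf (κ.layerSubgroup n))]
    (ξ : continuousCohomology 1 (subgroupRep X (κ.layerSubgroup (n + 1)))) :
    resLe X (κ.layerSubgroup_antitone (Nat.le_add_right n 1)) 1
        (coresLe X (κ.layerSubgroup_antitone (Nat.le_add_right n 1)) (κ.isOpen_layerSubgroup (n + 1)) ξ) =
      ∑ i ∈ Finset.range p, conjMap X (κ.layerSubgroup (n + 1)) (γ ^ (p ^ n * i)) 1 ξ := by
  classical
  have hs : ∀ x : κ.layerSubgroup n ⧸ (κ.layerSubgroup (n + 1)).subgroupOf (κ.layerSubgroup n),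
      ((Quotient.out x : κ.layerSubgroup n) :
        κ.layerSubgroup n ⧸ (κ.layerSubgroup (n + 1)).subgroupOf (κ.layerSubgroup n)) = x :=
    fun x ↦ QuotientGroup.out_eq' x
  rw [resLe_coresLe_eq_sum_conjMap X (κ.layerSubgroup_antitone (Nat.le_add_right n 1)) (κ.isOpen_layerSubgroup (n + 1)) hs ξ]
  have hF : ∀ x : κ.layerSubgroup n ⧸ (κ.layerSubgroup (n + 1)).subgroupOf (κ.layerSubgroup n),
      conjMap X (κ.layerSubgroup (n + 1)) ((Quotient.out x : κ.layerSubgroup n) : absoluteGaloisGroup K) 1 ξ =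
        conjMap X (κ.layerSubgroup (n + 1))
          (γ ^ (κ.layerIndex (n + 1) ((Quotient.out x : κ.layerSubgroup n) : absoluteGaloisGroup K)).val) 1 ξ :=
    fun x ↦ κ.conjMap_eq_conjMap_pow_of_isTopGenerator X hγ (n + 1) _ ξ
  rw [Finset.sum_congr rfl fun x _ ↦ hF x]
  have key := κ.sum_layerQuotient_eq (Nat.le_add_right n 1) hs
    (fun j ↦ conjMap X (κ.layerSubgroup (n + 1)) (γ ^ j) 1 ξ)
  beta_reduce at key
  rw [key, Nat.add_sub_cancel_left, pow_one]
  refine Finset.sum_congr rfl fun i _ ↦ ?_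
  rw [mul_comm]

end Layers

end ZpExtension

/-! ## §2 `Cor (proj (n+1) s) = proj n s` on `𝔖_p(K_∞)` when `E(K)[p] = 0` -/

end Literature.NumberTheory.EllipticCurves

namespace WeierstrassCurve

open Literature.NumberTheory.EllipticCurves Literature.NumberTheory.GaloisRepresentations

variable {K : Type u} [Field K] (V : WeierstrassCurve K)

/-- The discrete coefficient representation `discreteTopRep U (E[m])` of the tree's `subgroupH1` /
`torsionH1Over m U` IS `subgroupRep (E[m] as discrete Galois module).toTopRep U` (definitional; the number-field
twin of `Kato2004.discreteTopRep_torsion_eq`), so that `torsionH1Over m U` is literally the source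
`continuousCohomology 1 (subgroupRep (V.torsionGaloisModule m).toTopRep U)` of the tree's `coresLe`, `conjMap`
and of `ZpExtension.coresEisenstein`. [cite: SerreGaloisCohomology1997, I §2.2] -/
theorem discreteTopRep_geomTorsion_eq (m : ℤ) (U : Subgroup (absoluteGaloisGroup K)) :
    discreteTopRep U (geomTorsion V m) = subgroupRep (V.torsionGaloisModule m).toTopRep U :=
  rfl

/-- The tree's conjugation `conjH1 U (E[m]) σ` on `torsionH1Over m U` is `conjMap … σ 1` (definitional).
[cite: SerreLocalFields1979, VII.§5] -/
theorem conjH1_geomTorsion_eq_conjMap (m : ℤ) (U : Subgroup (absoluteGaloisGroup K)) [U.Normal]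
    (σ : absoluteGaloisGroup K) (c : V.torsionH1Over m U) :
    Literature.NumberTheory.EllipticCurves.conjH1 U (geomTorsion V m) σ c = conjMap (V.torsionGaloisModule m).toTopRep U σ 1 c :=
  rfl

/-- The tree's restriction `resOfLe (E[m]) h` between the `torsionH1Over` is `resLe … h 1` (definitional).
[cite: SerreGaloisCohomology1997, I §2.4] -/
theorem resOfLe_geomTorsion_eq_resLe (m : ℤ) {U U' : Subgroup (absoluteGaloisGroup K)} (h : U ≤ U')
    (c : V.torsionH1Over m U') :
    Literature.NumberTheory.EllipticCurves.resOfLe (geomTorsion V m) h c = resLe (V.torsionGaloisModule m).toTopRep h 1 c :=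
  rfl

namespace LambdaAdicSelmerData

variable [NumberField K] [V.IsElliptic] {V} {p : ℕ} [hp : Fact p.Prime] {κ : ZpExtension K p}
  {γ : absoluteGaloisGroup K} (D : V.LambdaAdicSelmerData κ γ)

/-- **Restriction between layers is injective on `H¹(Γ_n, E[p^k])` when `E(K)[p] = 0`** (one component of
the tree's `resPi_layer_injective_of_noPTorsion`: inflation–restriction, the kernel living on
`E[p^k]^{Gal(K̄/K_{n'})} ⊆ E(K_∞)[p^∞] = 0`). [cite: GreenbergLNM1716, §3 Lemma 3.1 and §4 p. 109] -/
theorem resOfLe_layer_injective_of_noPTorsion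
    (hE : ∀ P : V.toAffine.Point, p • P = 0 → P = 0) {n n' : ℕ}
    (h : κ.layerSubgroup n' ≤ κ.layerSubgroup n) (k : ℕ) :
    Function.Injective (Literature.NumberTheory.EllipticCurves.resOfLe (geomTorsion V ((p : ℤ) ^ k)) h) := by
  intro y y' hyy'
  have hinj := V.resPi_layer_injective_of_noPTorsion p κ hE h
  have key : V.resPi p h (Pi.single k y) = V.resPi p h (Pi.single k y') := by
    funext m
    simp only [resPi, AddMonoidHom.pi_apply, AddMonoidHom.coe_comp, Function.comp_apply,
      Pi.evalAddMonoidHom_apply]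
    by_cases hm : m = k
    · subst hm
      rw [Pi.single_eq_same, Pi.single_eq_same, hyy']
    · rw [Pi.single_eq_of_ne hm, Pi.single_eq_of_ne hm]
  have := congrFun (hinj key) k
  rwa [Pi.single_eq_same, Pi.single_eq_same] at this

/-- **`Cor_{K_{n+1}/K_n} (proj_{n+1} s) = proj_n s`** componentwise on `𝔖_p(K_∞)` when `E(K)[p] = 0`: for
`s ∈ 𝔖_p(K_∞)` (an element of `D.S`, `D : LambdaAdicSelmerData`), every layer `n` and every `k`, the
corestriction `H¹(Γ_{n+1}, E[p^k]) → H¹(Γ_n, E[p^k])` (the tree's `coresLe`) carries the `(n+1, k)`-component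
of `s` to its `(n, k)`-component. Proof: both have restriction `Σ_{i<p} conj_{γ^{p^n i}} (proj (n+1) s k)` to
`Γ_{n+1}` (`resLe_coresLe_layer_succ_eq_sum_conjMap`, resp. the pin `proj_norm`), and `res` is injective
(`resOfLe_layer_injective_of_noPTorsion`). This is Perrin-Riou's definition of `𝔖_p(K_∞)` as the limit ALONG
CORESTRICTION, recovered from the tree's restriction/norm pin. [cite: PerrinRiou1987BSMF, §0 p. 402]
[cite: Howard2004HeegnerKolyvagin, §2.2 and Def. 2.2.3] [cite: NeukirchSchmidtWingberg2008, I §5 (1.5.6)–(1.5.7)] -/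
theorem coresLe_proj_succ_eq_proj (hγ : κ.IsTopGenerator γ) (hE : ∀ P : V.toAffine.Point, p • P = 0 → P = 0)
    (n k : ℕ) [Fintype (κ.layerSubgroup n ⧸ (κ.layerSubgroup (n + 1)).subgroupOf (κ.layerSubgroup n))]
    (s : D.S) :
    coresLe (V.torsionGaloisModule ((p : ℤ) ^ k)).toTopRep (κ.layerSubgroup_antitone (Nat.le_add_right n 1))
        (κ.isOpen_layerSubgroup (n + 1)) (D.proj (n + 1) s k) = D.proj n s k := by
  apply resOfLe_layer_injective_of_noPTorsion hE (κ.layerSubgroup_antitone (Nat.le_add_right n 1)) k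
  -- the pin: `res (proj n s) = Σ_{i<p} conj_{γ^{p^n i}} (proj (n+1) s)`, `k`-th component
  have hnorm := congrFun (D.proj_norm n s) k
  simp only [resPi, conjPi, AddMonoidHom.pi_apply, AddMonoidHom.coe_comp, Function.comp_apply,
    Pi.evalAddMonoidHom_apply, Finset.sum_apply] at hnorm
  rw [hnorm, resOfLe_geomTorsion_eq_resLe, ZpExtension.resLe_coresLe_layer_succ_eq_sum_conjMap κ _ hγ n]
  rfl

/-- **Iterated form: `Cor_{K_{n'}/K_n} (proj_{n'} s) = proj_n s`** for `n < n'` (transitivity of the relative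
corestriction, `coresLe_comp`; the pattern of `Kato2004.IwasawaH1LayerNorm.coresLe_proj_eq_proj`), for any
finiteness structure on `Γ_n / Γ_{n'}`. [cite: PerrinRiou1987BSMF, §0 p. 402] [cite: NeukirchSchmidtWingberg2008, Prop. 1.5.3] -/
theorem coresLe_proj_eq_proj (hγ : κ.IsTopGenerator γ) (hE : ∀ P : V.toAffine.Point, p • P = 0 → P = 0)
    (k : ℕ) {n n' : ℕ} (hnn' : n < n')
    [hF : Fintype (κ.layerSubgroup n ⧸ (κ.layerSubgroup n').subgroupOf (κ.layerSubgroup n))] (s : D.S) :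
    coresLe (V.torsionGaloisModule ((p : ℤ) ^ k)).toTopRep (κ.layerSubgroup_antitone hnn'.le)
        (κ.isOpen_layerSubgroup n') (D.proj n' s k) = D.proj n s k := by
  have hfin : ∀ m : ℕ, (κ.layerSubgroup m).FiniteIndex := fun m ↦
    ⟨by rw [κ.index_layerSubgroup m]; exact pow_ne_zero _ hp.out.ne_zero⟩
  obtain ⟨d, rfl⟩ := Nat.exists_eq_add_of_lt hnn'
  induction d generalizing hF with
  | zero => exact D.coresLe_proj_succ_eq_proj hγ hE n k s
  | succ d ih =>
    haveI := hfin
    haveI hF1 : Fintype (κ.layerSubgroup n ⧸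
        (κ.layerSubgroup (n + d + 1)).subgroupOf (κ.layerSubgroup n)) := Fintype.ofFinite _
    haveI hF2 : Fintype (κ.layerSubgroup (n + d + 1) ⧸
        (κ.layerSubgroup (n + (d + 1) + 1)).subgroupOf (κ.layerSubgroup (n + d + 1))) :=
      Fintype.ofFinite _
    have hstep : coresLe (V.torsionGaloisModule ((p : ℤ) ^ k)).toTopRep
        (κ.layerSubgroup_antitone (Nat.le_succ (n + d + 1)))
        (κ.isOpen_layerSubgroup (n + (d + 1) + 1)) (D.proj (n + (d + 1) + 1) s k) = D.proj (n + d + 1) s k :=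
      D.coresLe_proj_succ_eq_proj hγ hE (n + d + 1) k s
    have hcomp := congrArg (fun f ↦ f (D.proj (n + (d + 1) + 1) s k))
      (coresLe_comp (V.torsionGaloisModule ((p : ℤ) ^ k)).toTopRep (H := κ.layerSubgroup (n + (d + 1) + 1))
        (H' := κ.layerSubgroup (n + d + 1)) (H'' := κ.layerSubgroup n)
        (κ.layerSubgroup_antitone (Nat.le_succ (n + d + 1)))
        (κ.layerSubgroup_antitone (Nat.lt_add_of_pos_right d.succ_pos).le)
        (κ.isOpen_layerSubgroup _) (κ.isOpen_layerSubgroup _))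
    simp only [LinearMap.coe_comp, Function.comp_apply] at hcomp
    rw [hstep, ih (Nat.lt_add_of_pos_right d.succ_pos)] at hcomp
    convert hcomp.symm using 3

end LambdaAdicSelmerData

end WeierstrassCurve

end
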